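import Literature.NumberTheory.GaloisRepresentations.GlobalReciprocityExistenceProofs
import Literature.NumberTheory.GaloisRepresentations.GlobalArtinMapAbstractExtensionProofs
import HarnessLib

/-!
# THE universal norm residue symbol `( , F) = lim ψ_{L|F} : C_F → Γ_F^ab` of the tree is a global reciprocity map,
# and it restricts to the Artin map `ψ_{E/F}` of every finite abelian layer
# (Neukirch, *Bonn Lectures* III §6 (6.13)–(6.14), Thm. (7.12); Tate, C–F VII §5.1, §5.4–5.6)

Topic `NumberTheory/GaloisRepresentations`; namespace `Literature.NumberTheory.GaloisRepresentations`.  Theorems only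
(no definition, no named fact, no instance, no notation, no `sorry`); number fields in `Type`.

The tree proves the reciprocity law as the EXISTENTIAL named fact `exists_isGlobalReciprocityMap K`
(`exists_isGlobalReciprocityMap_holds`); its proof (`exists_isGlobalReciprocityMap_of_keyLemma`) runs through ONE specific
map, the limit `θ = (isCompatibleSystem_artinMapFamily hR).theta : C_K →* Γ_K^ab` of the finite-level Artin maps
`ψ_{L|K}` (`artinMapFamily`, Tate 5.1 (A)–(C)).  This file records the non-existential statement and the finite-level
readings that consumers of the class formation need:

* §1 **`isGlobalReciprocityMap_artinTheta`**: `θ` IS a global reciprocity map (continuous, onto, kernel the divisible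
  classes, existence theorem) — the proof of `exists_isGlobalReciprocityMap_of_keyLemma` without its last `∃`-introduction
  (Key Lemma `exists_cyclic_charHecke_of_pow_prime_eq_one`, `galoisHecke_of_keyLemma`, Artin reciprocity for characters).
* §2 **`absRestrictNormalHom_eq_artinIdeleMap_of_absGaloisAbProj_eq`**: if `γ ∈ Γ_K` represents `θ[x]` then
  `γ|_L = ψ_{L|K}(x)` for every finite abelian `L ⊆ K̄`; and for an ABSTRACT finite abelian `E/K`
  (**`autCongr_symm_absRestrictNormalHom_eq_artinIdeleMapOfAlgebra`**): `e⁻¹ (γ|_{E₀}) e = ψ_{E/K}(x)` with `e : E ≃ E₀ ⊆ K̄`.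

HONEST FRAMING: classical global class field theory as already proved in the tree; this file only de-existentialises it.
Written for Route A of crux `AnticycControlAdditiveK` (cell bsd-schneider): with door-c6 g13's `carryInv_eq_neg_exponent_artin`
it identifies the class formation's pairing `inv(ι[x] ∪ δχ)` with THE map `θ` to which door-c6 g11's
`IsGlobalReciprocityMap.mem_range_pow_iff_forall_character` (`α¹(Γ_F, ℤ/m)` injective) applies.

## References
* J. Neukirch, *Class Field Theory — The Bonn Lectures* (2013), Part III §6 (6.13)–(6.14), §7 Thm. (7.7), (7.8), (7.12).
  [Neukirch2013]
* J. W. S. Cassels, A. Fröhlich (eds.), *Algebraic Number Theory* (1967), Ch. VII (J. Tate) §5.1 Main Theorem, §5.4–5.6, §12.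
  [CasselsFrohlichANT1967]
-/

noncomputable section

open scoped NumberField
open NumberField IsDedekindDomain Field Filter Polynomial

namespace Literature.NumberTheory.GaloisRepresentations

/-! ## §1. `θ = lim ψ_{L|K}` is a global reciprocity map -/

/-- **THE universal norm residue symbol of the tree is a global reciprocity map**: the limit
`θ = (isCompatibleSystem_artinMapFamily hR).theta : C_K →* Γ_K^ab` of the Artin maps `ψ_{L|K}` of the finite abelian
`L ⊆ K̄` is continuous and surjective, its kernel is the group of infinitely divisible classes, and every open subgroup of
finite index of `C_K` is the preimage of an open subgroup (`IsGlobalReciprocityMap`).  (Unconditional: Artin reciprocity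
for characters `artinReciprocity_character_holds` and the Key Lemma `exists_cyclic_charHecke_of_pow_prime_eq_one` are tree
theorems; this is `exists_isGlobalReciprocityMap_of_keyLemma` without the final existential.)
[cite: Neukirch2013, Part III Thm. (7.12)][cite: CasselsFrohlichANT1967, Ch. VII §5.1 Main Theorem, §5.4–5.6] -/
theorem isGlobalReciprocityMap_artinTheta (K : Type) [Field K] [NumberField K] :
    IsGlobalReciprocityMap K
      (isCompatibleSystem_artinMapFamily (K := K) artinReciprocity_character_holds).theta := by
  refine isGlobalReciprocityMap_theta_of_ker_cofinal artinReciprocity_character_holds fun N hN hfi =>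
    exists_ker_artinMapFamily_le_of_forall_isFiniteOrder artinReciprocity_character_holds (fun η hη => ?_) N hN hfi
  obtain ⟨L, hL, hab, χ, hηχ⟩ := galoisHecke_of_keyLemma artinReciprocity_character_holds
    exists_cyclic_charHecke_of_pow_prime_eq_one (orderOf η) K η rfl hη
  haveI := hL
  haveI := hab
  haveI : NumberField L := NumberField.of_module_finite K L
  refine exists_forall_artinMapFamily_eq_one_imp_of_eventually artinReciprocity_character_holds
    (ρ := inflateCharacter L χ) ?_
  filter_upwards [eventually_isUnramifiedIn (K := K) L] with v hunr _
  rw [hηχ, charHecke_valueAtUniformizer L χ _ hunr]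
  exact inflateCharacter_hasFrobCharpolyAt L χ (commute_of_isAbelianGalois L) hunr

/-! ## §2. `θ` restricts to `ψ_{L|K}` at every finite abelian layer -/

variable {K : Type} [Field K] [NumberField K]

/-- **`γ|_L = ψ_{L|K}(x)` for any representative `γ ∈ Γ_K` of `θ[x]`** and every finite abelian `L ⊆ K̄`.
[cite: Neukirch2013, Part III §6 (6.13), (6.14)][cite: CasselsFrohlichANT1967, Ch. VII §5.1 Main Theorem (C), §5.4] -/
theorem absRestrictNormalHom_eq_artinIdeleMap_of_absGaloisAbProj_eq (L : IntermediateField K (AlgebraicClosure K))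
    [FiniteDimensional K L] [NumberField L] [IsAbelianGalois K L] {x : ideleGroup K} {γ : absoluteGaloisGroup K}
    (h : absGaloisAbProj K γ =
      (isCompatibleSystem_artinMapFamily (K := K) artinReciprocity_character_holds).theta (QuotientGroup.mk x)) :
    absRestrictNormalHom L γ = artinIdeleMap L artinReciprocity_character_holds x := by
  have h1 := (isCompatibleSystem_artinMapFamily (K := K) artinReciprocity_character_holds).restrictNormalHom_eq_of_absGaloisAbProj_eq
    h L
  rw [artinMapFamily_eq, artinClassMap_mk] at h1
  exact h1

/-- **For an abstract finite abelian `E/K`: `e⁻¹ ∘ γ|_{E₀} ∘ e = ψ_{E/K}(x)`** (`e : E ≃ E₀ ⊆ K̄` the tree's embedded copy,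
`ψ_{E/K} = artinIdeleMapOfAlgebra K E`) for any representative `γ` of `θ[x]`.
[cite: Neukirch2013, Part III §6 (6.13), (6.14)][cite: CasselsFrohlichANT1967, Ch. VII §5.1 Main Theorem (C), §5.4] -/
theorem autCongr_symm_absRestrictNormalHom_eq_artinIdeleMapOfAlgebra (E : Type) [Field E] [NumberField E] [Algebra K E]
    [IsAbelianGalois K E] {x : ideleGroup K} {γ : absoluteGaloisGroup K}
    (h : absGaloisAbProj K γ =
      (isCompatibleSystem_artinMapFamily (K := K) artinReciprocity_character_holds).theta (QuotientGroup.mk x)) :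
    (embeddedEquiv K E).autCongr.symm (absRestrictNormalHom (embeddedField K E) γ) =
      artinIdeleMapOfAlgebra K E artinReciprocity_character_holds x := by
  rw [MulEquiv.symm_apply_eq, autCongr_artinIdeleMapOfAlgebra]
  exact absRestrictNormalHom_eq_artinIdeleMap_of_absGaloisAbProj_eq (embeddedField K E) h

/-- **`ψ_{E/K}(x) = 1 ↔ θ[x]` fixes `E₀`**: the finite-level Artin map of an abstract abelian `E/K` vanishes on `x` iff the
universal symbol `θ[x]` lies in the image of `Gal(K̄/E₀)` in `Γ_K^ab`.
[cite: Neukirch2013, Part III §6 (6.14)][cite: CasselsFrohlichANT1967, Ch. VII §5.4] -/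
theorem artinIdeleMapOfAlgebra_eq_one_iff_theta_mem (E : Type) [Field E] [NumberField E] [Algebra K E]
    [IsAbelianGalois K E] (x : ideleGroup K) :
    artinIdeleMapOfAlgebra K E artinReciprocity_character_holds x = 1 ↔
      (isCompatibleSystem_artinMapFamily (K := K) artinReciprocity_character_holds).theta (QuotientGroup.mk x) ∈
        abelianizedFixingSubgroup K (embeddedField K E) := by
  obtain ⟨γ, hγ, -⟩ := (isCompatibleSystem_artinMapFamily (K := K) artinReciprocity_character_holds).exists_absGaloisAbProj_eq_theta
    (QuotientGroup.mk x)
  rw [← autCongr_symm_absRestrictNormalHom_eq_artinIdeleMapOfAlgebra E hγ, MulEquiv.map_eq_one_iff,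
    mem_abelianizedFixingSubgroup_iff]
  constructor
  · intro h1
    refine ⟨γ, ?_, hγ⟩
    rw [IntermediateField.mem_fixingSubgroup_iff]
    intro y hy
    have h2 := AlgEquiv.restrictNormal_commutes (absoluteGaloisGroup.toAlgEquiv K γ) (embeddedField K E) ⟨y, hy⟩
    rw [show AlgEquiv.restrictNormal (absoluteGaloisGroup.toAlgEquiv K γ) (embeddedField K E) =
      absRestrictNormalHom (embeddedField K E) γ from rfl, h1, AlgEquiv.one_apply] at h2
    exact h2.symm
  · rintro ⟨σ, hσ, hσγ⟩
    rw [← hγ] at hσγ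
    -- `σ` and `γ` have the same image in `Γ_K^ab`, hence the same restriction to the abelian `E₀`
    have hres : absRestrictNormalHom (embeddedField K E) σ = absRestrictNormalHom (embeddedField K E) γ :=
      (absRestrictNormalHom_eq_artinIdeleMap_of_absGaloisAbProj_eq (embeddedField K E) (hσγ.trans hγ)).trans
        (absRestrictNormalHom_eq_artinIdeleMap_of_absGaloisAbProj_eq (embeddedField K E) hγ).symm
    rw [← hres]
    refine AlgEquiv.ext fun y => Subtype.ext ?_
    have h2 := AlgEquiv.restrictNormal_commutes (absoluteGaloisGroup.toAlgEquiv K σ) (embeddedField K E) y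
    rw [show AlgEquiv.restrictNormal (absoluteGaloisGroup.toAlgEquiv K σ) (embeddedField K E) =
      absRestrictNormalHom (embeddedField K E) σ from rfl] at h2
    change (algebraMap (embeddedField K E) (AlgebraicClosure K)) ((absRestrictNormalHom (embeddedField K E) σ) y) =
      (algebraMap (embeddedField K E) (AlgebraicClosure K)) ((1 : embeddedField K E ≃ₐ[K] embeddedField K E) y)
    rw [h2, AlgEquiv.one_apply]
    exact (IntermediateField.mem_fixingSubgroup_iff _ _).1 hσ y y.2

end Literature.NumberTheory.GaloisRepresentations

end
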